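import Literature.AlgebraicGeometry.AbelianSchemes.AbelianSchemeQuotientDualPairOfIdealTorsion
import Literature.AlgebraicGeometry.AbelianSchemes.ConstSubgroupQuotientKernelLawOfIdealTorsion
import Literature.AlgebraicGeometry.AbelianSchemes.IdealTorsionSectionsCardOfPerfect
import Literature.AlgebraicGeometry.AbelianSchemes.LevelStructureRangeOfTorsionSections
import Literature.AlgebraicGeometry.AbelianSchemes.LevelStructureOfAlgClosedField
import Literature.AlgebraicGeometry.AbelianSchemes.FibreHomDominantOfRingAction
import Literature.AlgebraicGeometry.AbelianSchemes.WeilDivisorPullbackOfRosatiAtPoint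
import Literature.AlgebraicGeometry.AbelianSchemes.DualPairFibreDimEq
import Literature.AlgebraicGeometry.AbelianSchemes.DualPairHatRelDimTransport
import Literature.AlgebraicGeometry.Motives.AbelianVarietyVerschiebung
import Literature.AlgebraicGeometry.Motives.AbelianVarietyWeilPairingRadical
import Literature.NumberTheory.NumberFields.IdealNormCoprimeLevel
import HarnessLib

/-!
# The dual pair of `A ⁄ A[𝔟](Ω)` for a representative `𝔟 = x·𝔞` prime to the level, with the ideal-shape kernel law

Layer `Literature/AlgebraicGeometry/AbelianSchemes`, namespace `Literature.AlgebraicGeometry.AbelianSchemes.AbelianSchemeOver`.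
THEOREMS ONLY (no definition, no named fact, no instance, no notation, no `sorry`).  Cell `hodgecm-mathlib` (D-0151),
FLOOR-0 programme, crux `hLiu418`, D-line L3 leaf `Cruxes/HLiu418/Lines/F0_P6a_StubFROB.lean` socket `stub_ROOF0`, road (ρ-𝔟)
«DUAL-Q AT x̄″» — THE HEAD (2b) of LA3-plan (g0) RULING «DUAL-B̄» #6 (2) ∕ DEAL UPDATE 2026-09-02T05:05:48Z ∕ RULING #7 (the (U)
unit-pin shape); author LA3-p03 (g2); count-neutral capital (`--supports stmt-HodgeConjecture-24832`).  HC_CM is proved only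
modulo the 7 printed citations until rung 0 closes; nothing in this file is about HC.

## Statement (generic; the x̄″-costume is a 6-line `obtain` in the Lines-side consumer)

`Ω` algebraically closed (any characteristic), `A ∕ Spec Ω` an abelian scheme of relative dimension `g` with a dual pair `D = (Â, 𝒫)`
and a homomorphism `λ : A → Â` which is `Λ(𝒪(Θ_s))` for an AMPLE `Θ_s` on every geometric fibre ([MumfordAV1970] §6, §8, §23;
the `Polarization.exists_ample` row); an action `ι : 𝓞 F → End(A)` of the integers of a number field `F` and a ring automorphism
`c` of `𝓞 F` satisfying the ROSATI LAW `ι(c b) ≫ λ = λ ≫ ι(b)^` ([MumfordAV1970] §20 p. 189 ∕ §21; for a CM field `c` = complex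
conjugation, [Shimura1998] §5.2); a nonzero ideal `𝔞 ⊆ 𝓞 F` and a level `M ≥ 1` divisible by the characteristic of `Ω` (if
positive).  THEN there are `x ∈ F^×`, an ideal `𝔟` IN THE CLASS OF `𝔞` (`𝔟 = x·𝔞` as fractional ideals, [Neukirch1999] I (3.8)–(3.9))
prime to `M`, an integer `n ≥ 1` prime to `M` with `n ∈ 𝔟` and `n ≠ 0` in `Ω`, the finite group `K = A[𝔟](Ω)` of sections killed by
`𝔟`, and A DUAL PAIR `DQ` of the free quotient `Q := A ⁄ K` ([MumfordAV1970] §7 Thm. 4 (p. 72), §15 Thm. 1 (p. 143), §23 Thm. 2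
(p. 231)) whose Poincaré sheaf is trivial along `Q × {ε}` (the unit pin), such that the quotient map `q : A → Q` has KERNEL LAW
`t ≫ q = 1 ↔ ∀ c ∈ 𝔟, t ≫ ι(c) = 1` on ALL `T`-points («`ker q = A[𝔟]`», i.e. `Q = A ⊗_𝒪 𝔟⁻¹`, [Conrad2004GrossZagier] §7 Thm. 7.5).

Assembly (all ★): the class representative prime to `M·#K(Θ)` and `n ∈ 𝔟` prime to it (★ `RingOfIntegers.exists_coprime_representative`,
★ `exists_nat_mem_coprime_level`, [Neukirch1999] I (3.9), [MilneANT2008] Thm. 3.7); `K := ⋂_{b ∈ 𝔟} ker(ι(b)_*)`,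
`K₂ := ⋂_{r ∈ c(J′)} ker(ι(r)_*)` with `𝔟·J′ = (n)`; `#K · #λ_*K₂ = n^{2g}` (★ `natCard_mul_natCard_map_eq_pow_of_idealTorsion`, the Weil-pairing
adjunction ★ `weilPairingLevel_map_fibreHom_eq_of_rosati`, perfectness prime to `#K(Θ)`); `λ_*K₂ ⊆ φ̂((ℤ∕n)^{2g})` for a level-`n` structure
`φ̂` of `Â` (★ `nonempty_levelStructure_of_isAlgClosed`, ★ `LevelStructure.map_isMonHom_monoidHom_subset_range_section_of_field`); the
ENGINE ★ `exists_dualPair_quotient_idealTorsion_geometric_of_unit` ([MumfordAV1970] §23 descent of `𝒫` through `K × λ_*K₂`); the kernel law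
★ `comp_quotientMk_eq_one_iff_forall_comp_i_eq_one_of_field`.

## References

* [MumfordAV1970] D. Mumford, *Abelian Varieties* (1970), §7 Thm. 4 (p. 72), §15 Thm. 1 (p. 143), §20 (pp. 184–189), §23 Thm. 2 (p. 231).
* [Conrad2004GrossZagier] B. Conrad, *Gross–Zagier revisited* (2004), §7 (Serre tensor construction, Thm. 7.5).
* [Neukirch1999] J. Neukirch, *Algebraic Number Theory* (1999), Ch. I §3 (3.8)–(3.9).
* [MilneANT2008] J. S. Milne, *Algebraic Number Theory* (v3.08, 2008), Thm. 3.7 and Rem. 3.12.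
* [Shimura1998] G. Shimura, *Abelian Varieties with Complex Multiplication and Modular Functions* (1998), §5.2.
-/

set_option autoImplicit false
set_option backward.isDefEq.respectTransparency false

noncomputable section

universe u

open CategoryTheory CategoryTheory.Limits AlgebraicGeometry MonoidalCategory CartesianMonoidalCategory
open scoped MonObj nonZeroDivisors Pointwise
open NumberField

namespace Literature.AlgebraicGeometry.AbelianSchemes

open Literature.AlgebraicGeometry.RelativeSpec Literature.AlgebraicGeometry.Motives Literature.AlgebraicGeometry.AbelianVarieties
open Literature.NumberTheory.NumberFields

namespace AbelianSchemeOver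

variable {Ω : Type u} [Field Ω] [IsAlgClosed Ω] (A : AbelianSchemeOver (Spec (.of Ω)))
  [IsSeparated (A.X.hom ≫ 𝟙 (Spec (.of Ω)))] [LocallyOfFiniteType (A.X.hom ≫ 𝟙 (Spec (.of Ω)))] (D : A.DualPair)

omit [IsAlgClosed Ω] [IsSeparated (A.X.hom ≫ 𝟙 (Spec (.of Ω)))] [LocallyOfFiniteType (A.X.hom ≫ 𝟙 (Spec (.of Ω)))] in
/-- If every prime `q` with `q = 0` in `Ω` divides `M`, then a positive integer prime to `M` is nonzero in `Ω`. [cite: MilneANT2008, Thm. 3.7] -/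
theorem natCast_ne_zero_of_coprime_of_forall_prime_dvd {M : ℕ} (hchar : ∀ q : ℕ, q.Prime → (q : Ω) = 0 → q ∣ M) {n : ℕ}
    (hn : 0 < n) (hcop : Nat.Coprime n M) : (n : Ω) ≠ 0 := by
  intro h
  obtain ⟨p, hp⟩ := CharP.exists Ω
  have hpn : p ∣ n := (CharP.cast_eq_zero_iff Ω p n).mp h
  rcases CharP.char_is_prime_or_zero Ω p with hprime | rfl
  · have hpM : p ∣ M := hchar p hprime (CharP.cast_eq_zero Ω p)
    exact hprime.one_lt.ne' (Nat.eq_one_of_dvd_coprimes hcop hpn hpM).symm.symm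
  · exact hn.ne' (Nat.eq_zero_of_zero_dvd hpn)

/-- **THE DUAL PAIR OF `A ⁄ A[𝔟](Ω)` FOR A CLASS REPRESENTATIVE `𝔟 = x·𝔞` PRIME TO THE LEVEL, WITH THE IDEAL-SHAPE KERNEL LAW AND THE
UNIT PIN** (the (2b) head «DUAL-Q»).  See the module docstring for the statement and the ★ assembly.
[cite: MumfordAV1970, §23 Thm. 2 (p. 231), §15 Thm. 1 (p. 143), §7 Thm. 4 (p. 72)] [cite: Conrad2004GrossZagier, §7 (Thm. 7.5)]
[cite: Neukirch1999, Ch. I §3 (3.8)–(3.9)] [cite: MilneANT2008, Thm. 3.7 and Rem. 3.12] -/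
theorem exists_idealClass_quotient_kernelLaw_dualPair {g : ℕ} (hA : A.IsOfRelDim g) (lam : A.X ⟶ D.hat.X) [IsMonHom lam]
    (hpol : ∀ ⦃Ω' : Type u⦄ [Field Ω'] [IsAlgClosed Ω'] (s : Spec (.of Ω') ⟶ Spec (.of Ω)),
      ∃ Θ : CartierDivisor (A.fibre s).toAbelianVariety.X.left, Θ.IsAmple ∧ A.IsLambdaOfAt s D lam Θ)
    {F : Type} [Field F] [NumberField F] (act : A.RingAction (𝓞 F)) (c : 𝓞 F ≃+* 𝓞 F)
    (hrosati : ∀ b : 𝓞 F, b ≠ 0 →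
      haveI := act.isMonHom b
      act.i (c b) ≫ lam = lam ≫ DualPair.dualIsogenyOver (act.i b) D D)
    (𝔞 : Ideal (𝓞 F)) (h𝔞 : 𝔞 ≠ ⊥) {M : ℕ} (hM : M ≠ 0) (hchar : ∀ q : ℕ, q.Prime → (q : Ω) = 0 → q ∣ M) :
    ∃ (x : F) (𝔟 : Ideal (𝓞 F)) (n : ℕ) (K : Subgroup A.Sections) (hfin : Finite K)
      (DQ : (haveI := hfin;
        A.quotientBy (𝟙 (Spec (.of Ω))) K (A.hcov_of_field K)
          (A.exists_grpObj_isMonHom_quotientMk_of_field K (A.hcov_of_field K))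
          (A.smooth_quotientOver_hom_of_field K (A.hcov_of_field K))
          (A.geometricallyConnected_quotientOver_hom (𝟙 (Spec (.of Ω))) K (A.hcov_of_field K))).DualPair),
      x ≠ 0 ∧ 𝔟 ≠ ⊥ ∧
      (𝔟 : FractionalIdeal (𝓞 F)⁰ F) = FractionalIdeal.spanSingleton (𝓞 F)⁰ x * (𝔞 : FractionalIdeal (𝓞 F)⁰ F) ∧
      𝔟 ⊔ Ideal.span {((M : ℕ) : 𝓞 F)} = ⊤ ∧ 0 < n ∧ Nat.Coprime n M ∧ ((n : ℕ) : 𝓞 F) ∈ 𝔟 ∧ (n : Ω) ≠ 0 ∧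
      (∀ σ : A.Sections, σ ∈ K ↔ ∀ b ∈ 𝔟, σ ≫ act.i b = 1) ∧
      (∀ ⦃T : Over (Spec (.of Ω))⦄ (t : T ⟶ A.X),
        (haveI := hfin;
          t ≫ (show A.X ⟶ (A.quotientBy (𝟙 (Spec (.of Ω))) K (A.hcov_of_field K)
            (A.exists_grpObj_isMonHom_quotientMk_of_field K (A.hcov_of_field K))
            (A.smooth_quotientOver_hom_of_field K (A.hcov_of_field K))
            (A.geometricallyConnected_quotientOver_hom (𝟙 (Spec (.of Ω))) K (A.hcov_of_field K))).X from
            A.quotientMk (𝟙 (Spec (.of Ω))) K (A.hcov_of_field K)) = 1) ↔ ∀ b ∈ 𝔟, t ≫ act.i b = 1) ∧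
      Nonempty ((Scheme.Modules.pullback (DualPair.unitHatSlice DQ)).obj DQ.P ≅ SheafOfModules.unit _) := by
  classical
  -- ### (0) instances over the field
  haveI : IsCommMonObj A.X := A.isCommMonObj_of_field
  haveI : IsCommMonObj D.hat.X := D.hat.isCommMonObj_of_field
  haveI : IsSeparated (D.hat.X.hom ≫ 𝟙 (Spec (.of Ω))) := D.hat.isSeparated_hom_comp_id
  haveI : LocallyOfFiniteType (D.hat.X.hom ≫ 𝟙 (Spec (.of Ω))) := D.hat.locallyOfFiniteType_hom_comp_id
  -- ### (1) the ample `Θ` at the closed point; `#K(Θ)` is finite and positive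
  obtain ⟨Θ, hΘamp, hΘ⟩ := hpol (𝟙 (Spec (.of Ω)))
  haveI : Finite ((A.fibre (𝟙 (Spec (.of Ω)))).toAbelianVariety.KTheta Θ) :=
    ((A.fibre (𝟙 (Spec (.of Ω)))).toAbelianVariety.finite_KTheta hΘamp).to_subtype
  have hKΘ : Nat.card ((A.fibre (𝟙 (Spec (.of Ω)))).toAbelianVariety.KTheta Θ) ≠ 0 := Nat.card_pos.ne'
  -- ### (2) the class representative `𝔟 = x·𝔞` prime to `M′ := M·#K(Θ)` and `n ∈ 𝔟` prime to `M′`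
  have hM' : M * Nat.card ((A.fibre (𝟙 (Spec (.of Ω)))).toAbelianVariety.KTheta Θ) ≠ 0 := mul_ne_zero hM hKΘ
  have hm : Ideal.span {(((M * Nat.card ((A.fibre (𝟙 (Spec (.of Ω)))).toAbelianVariety.KTheta Θ) : ℕ) : 𝓞 F))} ≠ ⊥ := by
    rw [Ne, Ideal.span_singleton_eq_bot]
    exact_mod_cast hM'
  obtain ⟨x, 𝔟, hx, h𝔟m, h𝔟x⟩ := RingOfIntegers.exists_coprime_representative 𝔞 _ h𝔞 hm
  have h𝔟0 : 𝔟 ≠ ⊥ := by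
    rintro rfl
    rw [FractionalIdeal.coeIdeal_bot, eq_comm, mul_eq_zero, FractionalIdeal.spanSingleton_eq_zero_iff,
      FractionalIdeal.coeIdeal_eq_zero] at h𝔟x
    rcases h𝔟x with h | h
    · exact hx h
    · exact h𝔞 h
  obtain ⟨n, hn, hncop', hn𝔟⟩ := exists_nat_mem_coprime_level h𝔟0 h𝔟m
  have hncop : Nat.Coprime n M := Nat.Coprime.coprime_mul_right_right hncop'
  have hcop : Nat.Coprime n (Nat.card ((A.fibre (𝟙 (Spec (.of Ω)))).toAbelianVariety.KTheta Θ)) :=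
    Nat.Coprime.coprime_mul_left_right hncop'
  have h𝔟M : 𝔟 ⊔ Ideal.span {((M : ℕ) : 𝓞 F)} = ⊤ :=
    top_le_iff.mp (h𝔟m.ge.trans (sup_le_sup_left (Ideal.span_singleton_le_span_singleton.mpr
      (Nat.cast_dvd_cast (Dvd.intro _ rfl))) _))
  have hn0 : (n : Ω) ≠ 0 := natCast_ne_zero_of_coprime_of_forall_prime_dvd hchar hn hncop
  have hN0 : n ≠ 0 := hn.ne'
  have hnO : ((n : ℕ) : 𝓞 F) ≠ 0 := by exact_mod_cast hN0
  haveI : IsDominant (AbelianVariety.Hom.toSchemeHom ((n : ℤ) • 𝟙 (A.fibre (𝟙 (Spec (.of Ω)))).toAbelianVariety)) :=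
    (A.fibre (𝟙 (Spec (.of Ω)))).toAbelianVariety.isDominant_toSchemeHom_zsmul_id (by exact_mod_cast hN0)
  -- ### (3) the partner `J′` with `𝔟·J′ = (n)`, and `𝔠 := c(J′)`, `𝔟′ := c(𝔟)` with `𝔠·𝔟′ = (n)`
  obtain ⟨J', h𝔟J'⟩ := exists_mul_eq_span_natCast_of_mem hn𝔟
  have hJ'0 : J' ≠ ⊥ := ne_bot_of_mul_eq_span_natCast hN0 h𝔟J'
  have hnJ' : ((n : ℕ) : 𝓞 F) ∈ J' := Ideal.mul_le_left (h𝔟J'.symm ▸ Ideal.mem_span_singleton_self _)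
  have hnJ : ((n : ℕ) : 𝓞 F) ∈ J'.map (c : 𝓞 F →+* 𝓞 F) := by
    have h := Ideal.mem_map_of_mem (c : 𝓞 F →+* 𝓞 F) hnJ'
    rwa [RingHom.coe_coe, map_natCast] at h
  have hcinj : Function.Injective ((c : 𝓞 F →+* 𝓞 F) : 𝓞 F → 𝓞 F) := fun a b h =>
    c.injective (by simpa only [RingHom.coe_coe] using h)
  have h𝔟'0 : 𝔟.map (c : 𝓞 F →+* 𝓞 F) ≠ ⊥ := by
    rw [Ne, Ideal.map_eq_bot_iff_of_injective hcinj]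
    exact h𝔟0
  have h𝔠 : J'.map (c : 𝓞 F →+* 𝓞 F) * 𝔟.map (c : 𝓞 F →+* 𝓞 F) = Ideal.span {((n : ℕ) : 𝓞 F)} := by
    rw [← Ideal.map_mul, mul_comm, h𝔟J', Ideal.map_span, Set.image_singleton, RingHom.coe_coe, map_natCast]
  -- ### (4) the Rosati rows for `𝔟′ = c(𝔟)` (partner `b := c⁻¹ j ∈ 𝔟`; dominance of `ι(b)` on every geometric fibre)
  have hros : ∀ ⦃Ω' : Type u⦄ [Field Ω'] [IsAlgClosed Ω'] (s : Spec (.of Ω') ⟶ Spec (.of Ω)),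
      ∀ j ∈ 𝔟.map (c : 𝓞 F →+* 𝓞 F), j ≠ 0 → ∃ b ∈ 𝔟,
        (haveI := act.isMonHom b; IsDominant (AbelianVariety.Hom.toSchemeHom (fibreHom (act.i b) s))) ∧
        (haveI := act.isMonHom b; act.i j ≫ lam = lam ≫ DualPair.dualIsogenyOver (act.i b) D D) := by
    intro Ω' _ _ s j hj hj0
    rw [Ideal.map_comap_of_equiv, Ideal.mem_comap] at hj
    have hjc : j = c (c.symm j) := (c.apply_symm_apply j).symm
    have hb0 : c.symm j ≠ 0 := fun h => hj0 (by rw [hjc, h, map_zero])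
    refine ⟨c.symm j, hj, isDominant_toSchemeHom_fibreHom_i_of_ne_zero act s hb0, ?_⟩
    have h := hrosati (c.symm j) hb0
    rw [← hjc] at h
    exact h
  -- ### (5) the torsion subgroups `K := A[𝔟](Ω)`, `K₂ := A[𝔠](Ω)` of sections
  let K : Subgroup A.Sections :=
    ⨅ b : 𝔟, (haveI := act.isMonHom (b : 𝓞 F); IsMonHom.monoidHom (act.i (b : 𝓞 F)) (𝟙_ (Over (Spec (.of Ω))))).ker
  have hKmem : ∀ σ : A.Sections, σ ∈ K ↔ ∀ b ∈ 𝔟, σ ≫ act.i b = 1 := fun σ => by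
    simp only [K, Subgroup.mem_iInf, MonoidHom.mem_ker, Subtype.forall]
    rfl
  let K₂ : Subgroup A.Sections :=
    ⨅ r : J'.map (c : 𝓞 F →+* 𝓞 F),
      (haveI := act.isMonHom (r : 𝓞 F); IsMonHom.monoidHom (act.i (r : 𝓞 F)) (𝟙_ (Over (Spec (.of Ω))))).ker
  have hK₂mem : ∀ σ : A.Sections, σ ∈ K₂ ↔ ∀ r ∈ J'.map (c : 𝓞 F →+* 𝓞 F), σ ≫ act.i r = 1 := fun σ => by
    simp only [K₂, Subgroup.mem_iInf, MonoidHom.mem_ker, Subtype.forall]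
    rfl
  have hK𝔟 : ∀ (κ : K), ∀ b ∈ 𝔟, (κ : A.Sections) ≫ act.i b = 1 := fun κ => (hKmem κ).1 κ.2
  have hK₂𝔠 : ∀ (σ : K₂), ∀ r ∈ J'.map (c : 𝓞 F →+* 𝓞 F), (σ : A.Sections) ≫ act.i r = 1 := fun σ => (hK₂mem σ).1 σ.2
  have hKn : ∀ σ : K, (σ : A.Sections) ^ n = 1 := fun σ =>
    A.pow_eq_one_of_forall_comp_i_eq_one_of_natCast_mem act hn𝔟 (σ : A.Sections) (hK𝔟 σ)
  have hK₂n : ∀ σ : K₂, (σ : A.Sections) ^ n = 1 := fun σ =>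
    A.pow_eq_one_of_forall_comp_i_eq_one_of_natCast_mem act hnJ (σ : A.Sections) (hK₂𝔠 σ)
  -- ### (6) `hcard : #K · #λ_*K₂ = n^{2g}` (Weil-pairing adjunction from the Rosati law, perfectness prime to `#K(Θ)`)
  have hsurj1 : ∀ r : 𝓞 F, r ≠ 0 → Function.Surjective (fun x : (A.fibre (𝟙 (Spec (.of Ω)))).toAbelianVariety.Points Ω =>
      haveI := act.isMonHom r; AlgPoints.map (fibreHom (act.i r) (𝟙 (Spec (.of Ω)))).hom.hom.hom x) :=
    fun r hr => map_fibreHom_i_surjective_of_ne_zero act (𝟙 (Spec (.of Ω))) hr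
  have hadj : ∀ b : 𝓞 F, b ≠ 0 → ∀ P Q P' Q' : (A.fibre (𝟙 (Spec (.of Ω)))).toAbelianVariety.torsionPoints Ω n,
      (P' : (A.fibre (𝟙 (Spec (.of Ω)))).toAbelianVariety.Points Ω) =
        (haveI := act.isMonHom b; AlgPoints.map (fibreHom (act.i b) (𝟙 (Spec (.of Ω)))).hom.hom.hom P) →
      (Q' : (A.fibre (𝟙 (Spec (.of Ω)))).toAbelianVariety.Points Ω) =
        (haveI := act.isMonHom (c b); AlgPoints.map (fibreHom (act.i (c b)) (𝟙 (Spec (.of Ω)))).hom.hom.hom Q) →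
      (A.fibre (𝟙 (Spec (.of Ω)))).toAbelianVariety.weilPairingLevel Θ P' Q =
        (A.fibre (𝟙 (Spec (.of Ω)))).toAbelianVariety.weilPairingLevel Θ P Q' := by
    intro b hb P Q P' Q' hP hQ
    haveI := act.isMonHom b
    haveI := act.isMonHom (c b)
    haveI := isDominant_toSchemeHom_fibreHom_i_of_ne_zero act (𝟙 (Spec (.of Ω))) hb
    exact weilPairingLevel_map_fibreHom_eq_of_rosati D lam (𝟙 (Spec (.of Ω))) hΘ (act.i b) (act.i (c b)) (hrosati b hb)
      P Q P' Q' hP hQ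
  have hcard : Nat.card K * Nat.card (K₂.map (IsMonHom.monoidHom lam (𝟙_ (Over (Spec (.of Ω)))))) = n ^ (2 * g) :=
    natCard_mul_natCard_map_eq_pow_of_idealTorsion act
      (fun r x => haveI := act.isMonHom r; AlgPoints.map (fibreHom (act.i r) (𝟙 (Spec (.of Ω)))).hom.hom.hom x)
      (fun _ _ => rfl) D lam hA hn0 hnO hsurj1 hΘ hcop c h𝔟0 hJ'0 h𝔟J' hadj K K₂ hKmem hK₂mem
  -- ### (7) finiteness of `K` and `K₂`
  have hpow0 : n ^ (2 * g) ≠ 0 := pow_ne_zero _ hN0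
  haveI hfinK : Finite K := Nat.finite_of_card_ne_zero (fun h => hpow0 (by rw [← hcard, h, zero_mul]))
  haveI hfinK₂ : Finite K₂ := by
    refine Nat.finite_of_card_ne_zero fun h => hpow0 ?_
    rw [← hcard, natCard_map_monoidHom_eq_of_coprime D lam hΘ hcop K₂ hK₂n, h, mul_zero]
  -- ### (8) the level-`n` structure on `Â` and `λ_*K₂ ⊆ φ̂((ℤ∕n)^{2g})`
  have hDhat : D.hat.IsOfRelDim g := by
    have h := DualPair.isOfRelDim_hat_dim_toAffine D
    rwa [dim_toAffine_toAbelianVariety_of_isOfRelDim hA] at h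
  obtain ⟨φ⟩ := D.hat.nonempty_levelStructure_of_isAlgClosed (n := n) hDhat hn0
  have hK'φ : ((K₂.map (IsMonHom.monoidHom lam (𝟙_ (Over (Spec (.of Ω)))))) : Set D.hat.Sections) ⊆ Set.range φ.section_ :=
    LevelStructure.map_isMonHom_monoidHom_subset_range_section_of_field φ hn0 K₂ hK₂n lam
  -- ### (9) the engine (with the unit pin)
  have hpol' : ∀ ⦃Ω' : Type u⦄ [Field Ω'] [IsAlgClosed Ω'] (s : Spec (.of Ω') ⟶ Spec (.of Ω)),
      ∃ Θ : CartierDivisor (A.fibre s).toAbelianVariety.X.left, A.IsLambdaOfAt s D lam Θ := fun Ω' _ _ s => by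
    obtain ⟨Θ', -, h⟩ := hpol s
    exact ⟨Θ', h⟩
  have hsurj : ∀ ⦃Ω' : Type u⦄ [Field Ω'] [IsAlgClosed Ω'] (s : Spec (.of Ω') ⟶ Spec (.of Ω)) (r : 𝓞 F), r ≠ 0 →
      haveI := act.isMonHom r
      Function.Surjective (fun x : (A.fibre s).toAbelianVariety.Points Ω' => AlgPoints.map (fibreHom (act.i r) s).hom.hom.hom x) :=
    fun Ω' _ _ s r hr => map_fibreHom_i_surjective_of_ne_zero act s hr
  obtain ⟨DQ, hDQ⟩ := A.exists_dualPair_quotient_idealTorsion_geometric_of_unit D hA lam hpol' act hsurj hn0 h𝔟'0 h𝔠 hros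
    K hKn hK𝔟 K₂ hK₂n hK₂𝔠 φ hK'φ hcard
  -- ### (10) assemble, with the ideal-shape kernel law (★ (b5))
  exact ⟨x, 𝔟, n, K, hfinK, DQ, hx, h𝔟0, h𝔟x, h𝔟M, hn, hncop, hn𝔟, hn0, hKmem,
    fun T t => A.comp_quotientMk_eq_one_iff_forall_comp_i_eq_one_of_field act hA hn0 hn𝔟 K hKmem t, hDQ⟩

end AbelianSchemeOver

end Literature.AlgebraicGeometry.AbelianSchemes

end
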